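/-
Origin: expansion seat `prover-pub-hodgecm-mc-binder-2-g14-0`, handover #S1 2026-08-20T12:17Z md5 e6d38992c391 (PKG 91022faa3afd → e6d38992c391; 174 l.; CENSUS TWIST: `def datumAtσ V S jD jI (σ : InfinitePlace L → Equiv.Perm (Fin 2))` (= the RUN-50 `datumAt` body with `σ b` applied to the chosen W-line index before the `= 0` orientation test) + `abbrev datumAt := datumAtσ … 1` (BYTE-COMPATIBLE); `datumAt_of_eq/_kind_of_eq/_kind_of_sigma/_of_delta/_kind_of_delta` restated over `datumAtσ σ`, σ implicit; NAME LIST: HodgeCM.Model.HypCensus.datumAt_kind_of_sigma) (`HOME/mc/pub-hodgecm-mc-binder-2/g14/s5b/HodgeCM/Model/HypCensus/PlaceChoice.lean`, md5 e6d38992c391, 174 lines);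
landed by the gen-20 packager (p-g20) in gate run 51 REPLACES the earlier landed copy of `HodgeCM/Model/HypCensus/PlaceChoice.lean` (seat copy carried the packager Origin header of an earlier run (stripped)).
-/
/-
Origin: speedrun cell pub-hodgecm, MODEL-CONSTRUCTION sub-cell, lineage mc-binder-2 (BINDER-OWNERS rows 18/19: E binders
`hyp12` / `hyp34` of `Model.perL_picardCM_r15A`), seat prover-pub-hodgecm-mc-binder-2-g10-0 (gen 10), 2026-08-19.
Target in PKG: `HodgeCM/Model/HypCensus/PlaceChoice.lean` (NEW additive leaf; imports this lineage's `HypCensus/PlaceDatum` (#27a),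
mc-unitary-1's `Model/WmInstanceV2` and mc-discharge-4's `HypCensus/DefiniteVacuumExponent` (both RUN 36 INSTALLED)).
KERNEL ONLY: 0 records, nothing cited, 0 `def … : Prop`; one data def (`datumAt`) + lemmas.
-/
import Summits.HodgeConjecture.HodgeCM.Model.HypCensus.PlaceDatum_2
import Summits.HodgeConjecture.HodgeCM.Model.WmInstanceV2
import Summits.HodgeConjecture.HodgeCM.Model.HypCensus.DefiniteVacuumExponent_2

/-!
# Census kit (rows A12/A34): the CHOICE of the place data of a context from its sign facts

`HypCensus/PlaceDatum` (#27a) left the per-place datum `datum b : PlaceDatum … (cmPlacesEquiv L b)` a parameter.  For E's pin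
(`V : HermSpace3 L ι₁`, seesaw datum `S`, frame of record `(frameD V, dW S)`) this leaf CHOOSES it from the sign facts alone:

* at the place of `ι₁` (`cmPlacesEquiv L b = cmPlace L ι₁`): kind `ι₁` (`PlaceDatum.iota (jI b)`);
* at any other place where `W = ⟨a₀⟩ ⊕ ⟨a₁⟩` is INDEFINITE (both `W`-blocks of `cmXW` non-empty): kind `Σ₁₂`, orientation read off the
  `V`-blocks — `V` IS definite there (`HermSpace3.posDef_of_ne` through mc-unitary-1's `frameD_sign_of_ne` and mc-discharge-4's
  `isEmpty_posIdx_or_negIdx_placeSignVec`), so exactly one `V`-block is empty: `sigmaPos` if `Q = ∅`, `sigmaNeg` if `P = ∅`; the two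
  `W`-blocks are singletons (`M = 2`, both non-empty: `subsingleton_posIdx_negIdx_two`); (T12) PRINTED ORIENTATION (RULING S5 (B1),
  2026-08-20): the printed `Σ₁₂` model attaches its first variable to `W₁ = ⟨a₀⟩` (line `0`); this is the Weil scaling iff the
  `W`-line paired POSITIVELY with `V_b` is line `0` — i.e. iff the positive `W`-line `r₀` is `0` (when `Q = ∅`) resp. the negative
  `W`-line `s₀` is `0` (when `P = ∅`) —; otherwise (`ε_b = −1`) the datum is the swapped one, `sigmaPosSwap` / `sigmaNegSwap`
  (kind `sigmaSwap`, model `LocalFock.ofPrintMCircleSwap`); for the rows on the TWISTED torus `jT₃₄` (#52: chart element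
  `h·diag(swap_σ u)·h⁻¹`, `σ_b = placePerm`) the line indices are read through `σ_b` first — `datumAtσ σ`; `datumAt = datumAtσ 1`;
* elsewhere: kind `D₁₂` (`PlaceDatum.delta (jD b)`).

The variable identifications `jD b`, `jI b` of the `D₁₂` / `ι₁` places stay PARAMETERS (they carry no obligation in #27a; the (J-x₀)/(J-T)
leaves fix them).  No sign hypothesis is needed for the DEFINITION; under `GoodCtx` (`W` definite at `ι₁`) the kinds are the printed
ones of PerL Lemma 4.1 (setup D4).  Lemmas: `datumAt_of_eq` / `datumAt_kind_of_eq` (ι₁), `datumAt_kind_of_sigma`, `datumAt_kind_of_delta`.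
Nothing here is a claim of PerL/QW8.  Style lint (L-notation): no `local notation`.
-/

set_option autoImplicit false

noncomputable section

open scoped Classical
open NumberField NumberField.InfinitePlace
open Literature.NumberTheory.Weil1964 Literature.NumberTheory.Automorphic
open HodgeCM HodgeCM.Model
open HodgeCM.PerL34.Fock HodgeCM.PerL34.Fock.PrintDict

namespace HodgeCM.Model.HypCensus

/-! ## §1 Two-line bookkeeping: an indefinite plane has one line of each sign -/

section Two

variable {x : Fin 2 → ℝ}

/-- for a sign vector of length `2` with a positive and a non-positive entry, both index blocks are singletons. -/
theorem subsingleton_posIdx_negIdx_two (hP : Nonempty (PosIdx x)) (hN : Nonempty (NegIdx x)) :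
    Subsingleton (PosIdx x) ∧ Subsingleton (NegIdx x) := by
  have hsum : Fintype.card (PosIdx x) + Fintype.card (NegIdx x) = 2 := by
    rw [← Fintype.card_sum, ← Fintype.card_congr (signSplit x), Fintype.card_fin]
  have h1 : 0 < Fintype.card (PosIdx x) := Fintype.card_pos_iff.2 hP
  have h2 : 0 < Fintype.card (NegIdx x) := Fintype.card_pos_iff.2 hN
  exact ⟨Fintype.card_le_one_iff_subsingleton.1 (by omega), Fintype.card_le_one_iff_subsingleton.1 (by omega)⟩

end Two

/-! ## §2 The choice -/

section Choice

variable {L : CMField} {ι₁ : L →+* ℂ} (V : HermSpace3 L ι₁) (S : StubTree.SeesawDatum L)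
variable (jD : InfinitePlace (L : Type) → EqVar → Fin 6) (jI : InfinitePlace (L : Type) → PlaneVar → Fin 6)

/-- off the place of `ι₁`, `V` is definite in the canonical frame: one of the two `V`-blocks is empty. -/
theorem isEmpty_posIdx_or_negIdx_cmXV (b : InfinitePlace (L : Type))
    (hb : cmPlacesEquiv (L : Type) b ≠ cmPlace (L : Type) ι₁) :
    IsEmpty (PosIdx (cmXV (L : Type) (frameD V) (frameD_real V) ι₁ (cmPlacesEquiv (L : Type) b))) ∨
      IsEmpty (NegIdx (cmXV (L : Type) (frameD V) (frameD_real V) ι₁ (cmPlacesEquiv (L : Type) b))) :=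
  isEmpty_posIdx_or_negIdx_placeSignVec (L : Type) (frameD V) (frameD_real V)
    (fun v => cmSignConv_ne_zero (L : Type) (frameD V) ι₁ v) ι₁ (frameD_sign_of_ne V) (cmPlacesEquiv (L : Type) b)
    fun h => hb (Subtype.ext h)

/-- **The place data of the pin, chosen from the sign facts, for the torus twisted by `σ`** (see the module docstring; `σ_b` permutes
the two `W`-line indices before the orientation test: `σ = 1` for the `jT₁₂` rows, `σ_b = placePerm` of #52 for the `jT₃₄` rows). -/
def datumAtσ (σ : InfinitePlace (L : Type) → Equiv.Perm (Fin 2)) (b : InfinitePlace (L : Type)) :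
    PlaceDatum (L : Type) (frameD V) (frameD_real V) (dW S) (dW_real S) ι₁ (cmPlacesEquiv (L : Type) b) :=
  if hι : cmPlacesEquiv (L : Type) b = cmPlace (L : Type) ι₁ then PlaceDatum.iota (jI b)
  else if hsig : Nonempty (PosIdx (cmXW (L : Type) (frameD V) (dW S) (dW_real S) ι₁ (cmPlacesEquiv (L : Type) b))) ∧
      Nonempty (NegIdx (cmXW (L : Type) (frameD V) (dW S) (dW_real S) ι₁ (cmPlacesEquiv (L : Type) b))) then
    if hQ : IsEmpty (NegIdx (cmXV (L : Type) (frameD V) (frameD_real V) ι₁ (cmPlacesEquiv (L : Type) b))) then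
      if σ b (Classical.choice hsig.1).1 = 0 then
        PlaceDatum.sigmaPos
          ((cmEpsV (L : Type) (frameD V) (frameD_real V) ι₁ (cmPlacesEquiv (L : Type) b)).trans
            (@Equiv.sumEmpty _ _ hQ))
          hQ (Classical.choice hsig.1) (Classical.choice hsig.2)
          (subsingleton_posIdx_negIdx_two hsig.1 hsig.2).1 (subsingleton_posIdx_negIdx_two hsig.1 hsig.2).2
      else
        PlaceDatum.sigmaPosSwap
          ((cmEpsV (L : Type) (frameD V) (frameD_real V) ι₁ (cmPlacesEquiv (L : Type) b)).trans
            (@Equiv.sumEmpty _ _ hQ))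
          hQ (Classical.choice hsig.1) (Classical.choice hsig.2)
          (subsingleton_posIdx_negIdx_two hsig.1 hsig.2).1 (subsingleton_posIdx_negIdx_two hsig.1 hsig.2).2
    else
      if σ b (Classical.choice hsig.2).1 = 0 then
        PlaceDatum.sigmaNeg
          ((cmEpsV (L : Type) (frameD V) (frameD_real V) ι₁ (cmPlacesEquiv (L : Type) b)).trans
            (@Equiv.emptySum _ _ ((isEmpty_posIdx_or_negIdx_cmXV V b hι).resolve_right hQ)))
          ((isEmpty_posIdx_or_negIdx_cmXV V b hι).resolve_right hQ) (Classical.choice hsig.1) (Classical.choice hsig.2)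
          (subsingleton_posIdx_negIdx_two hsig.1 hsig.2).1 (subsingleton_posIdx_negIdx_two hsig.1 hsig.2).2
      else
        PlaceDatum.sigmaNegSwap
          ((cmEpsV (L : Type) (frameD V) (frameD_real V) ι₁ (cmPlacesEquiv (L : Type) b)).trans
            (@Equiv.emptySum _ _ ((isEmpty_posIdx_or_negIdx_cmXV V b hι).resolve_right hQ)))
          ((isEmpty_posIdx_or_negIdx_cmXV V b hι).resolve_right hQ) (Classical.choice hsig.1) (Classical.choice hsig.2)
          (subsingleton_posIdx_negIdx_two hsig.1 hsig.2).1 (subsingleton_posIdx_negIdx_two hsig.1 hsig.2).2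
  else PlaceDatum.delta (jD b)

/-- **The place data of the pin for the `jT₁₂` rows** (no twist): the census of record since RUN 36, now `datumAtσ 1`. -/
abbrev datumAt (b : InfinitePlace (L : Type)) :
    PlaceDatum (L : Type) (frameD V) (frameD_real V) (dW S) (dW_real S) ι₁ (cmPlacesEquiv (L : Type) b) :=
  datumAtσ V S jD jI (1 : InfinitePlace (L : Type) → Equiv.Perm (Fin 2)) b

variable {σ : InfinitePlace (L : Type) → Equiv.Perm (Fin 2)}

/-- at the place of `ι₁` the datum is `iota (jI b)`. -/
theorem datumAt_of_eq (b : InfinitePlace (L : Type)) (h : cmPlacesEquiv (L : Type) b = cmPlace (L : Type) ι₁) :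
    datumAtσ V S jD jI σ b = PlaceDatum.iota (jI b) := by
  unfold datumAtσ
  rw [dif_pos h]

/-- … so its kind is `ι₁`. -/
theorem datumAt_kind_of_eq (b : InfinitePlace (L : Type)) (h : cmPlacesEquiv (L : Type) b = cmPlace (L : Type) ι₁) :
    (datumAtσ V S jD jI σ b).kind = PlaceKind.iota := by
  rw [datumAt_of_eq V S jD jI b h]
  rfl

/-- at a `W`-indefinite place off `ι₁` the kind is `Σ₁₂`, of one of the two (T12) orientations. -/
theorem datumAt_kind_of_sigma (b : InfinitePlace (L : Type)) (h : cmPlacesEquiv (L : Type) b ≠ cmPlace (L : Type) ι₁)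
    (hsig : Nonempty (PosIdx (cmXW (L : Type) (frameD V) (dW S) (dW_real S) ι₁ (cmPlacesEquiv (L : Type) b))) ∧
      Nonempty (NegIdx (cmXW (L : Type) (frameD V) (dW S) (dW_real S) ι₁ (cmPlacesEquiv (L : Type) b)))) :
    (datumAtσ V S jD jI σ b).kind = PlaceKind.sigma ∨ (datumAtσ V S jD jI σ b).kind = PlaceKind.sigmaSwap := by
  unfold datumAtσ
  rw [dif_neg h, dif_pos hsig]
  split
  · split
    · exact Or.inl rfl
    · exact Or.inr rfl
  · split
    · exact Or.inl rfl
    · exact Or.inr rfl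

/-- at a `W`-definite place off `ι₁` the datum is `delta (jD b)`. -/
theorem datumAt_of_delta (b : InfinitePlace (L : Type)) (h : cmPlacesEquiv (L : Type) b ≠ cmPlace (L : Type) ι₁)
    (hsig : ¬ (Nonempty (PosIdx (cmXW (L : Type) (frameD V) (dW S) (dW_real S) ι₁ (cmPlacesEquiv (L : Type) b))) ∧
      Nonempty (NegIdx (cmXW (L : Type) (frameD V) (dW S) (dW_real S) ι₁ (cmPlacesEquiv (L : Type) b))))) :
    datumAtσ V S jD jI σ b = PlaceDatum.delta (jD b) := by
  unfold datumAtσ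
  rw [dif_neg h, dif_neg hsig]

/-- … so its kind is `D₁₂`. -/
theorem datumAt_kind_of_delta (b : InfinitePlace (L : Type)) (h : cmPlacesEquiv (L : Type) b ≠ cmPlace (L : Type) ι₁)
    (hsig : ¬ (Nonempty (PosIdx (cmXW (L : Type) (frameD V) (dW S) (dW_real S) ι₁ (cmPlacesEquiv (L : Type) b))) ∧
      Nonempty (NegIdx (cmXW (L : Type) (frameD V) (dW S) (dW_real S) ι₁ (cmPlacesEquiv (L : Type) b))))) :
    (datumAtσ V S jD jI σ b).kind = PlaceKind.delta := by
  rw [datumAt_of_delta V S jD jI b h hsig]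
  rfl

end Choice

end HodgeCM.Model.HypCensus

end
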